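import Literature.Barriers.CriticalPhenomena.TimarNonunimodularLevels
import HarnessLib

/-!
# Timár 2006, §4 (set-up of the proof of Thm. 4.3): the level grid `ℓ_i`, long edges, slabs
# `G(ℓ_{j+1}, ℓ_j]` and their separating property — PROVED

Barrier catalogue `Literature/Barriers/CriticalPhenomena/`; a brick of the programme behind the
named fact `Timar2006_atMostOneCriticalCluster` (`SubexponentialGrowthZdUniqueness.lean`), on
the way to Timár's Thm. 4.3 (no infinite light clusters at `p_c`; vendored in
`TimarCriticalNonunimodular.lean`). The proof of Thm. 4.3 (Á. Timár, *Percolation on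
nonunimodular transitive graphs*, Ann. Probab. 34 (2006) 2344–2364, pp. 2353–2356) opens:
"Fix a vertex `o` on level `ℓ_0` and let `ℓ_1` be the lowest level that contains a vertex
adjacent (in `G`) to `o`. Let the edges between `o` and `ℓ_1` be called *long edges* (from `o`)
… We may assume that the weight of `ℓ_0` is `1`. If the weight of `ℓ_1` is `Δ`, then let `ℓ_i`
be the level with weight `Δ^i`. Note that `(G(ℓ_{i+1}, ℓ_i])_i` is a sequence of separating sets
of levels that satisfies the properties of the `(L_i)_i` in Lemma 4.2", where (p. 2352) "Given
level `ℓ`, and level `ℓ'` below `ℓ`, the set of vertices above `ℓ'` and below `ℓ` together with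
`ℓ` (but not including `ℓ'`) will be called the vertices *between* `ℓ` and `ℓ'`. Let `G(ℓ', ℓ]`
denote the subgraph of `G` induced by vertices between `ℓ` and `ℓ'`", and (p. 2353) "A
*separating set of levels* will be the set `L` of levels between two fixed levels `l_1` and
`l_2`, `l_2` below `l_1`, such that there is no path from the vertices above `l_1` to the
vertices below `l_2` that is disjoint from `L`."

On a connected, locally finite, transitive (`IsGraphTransitive`), nonunimodular graph with the
weights `w = autWeight G o` (`w(o) = 1`) of `TimarNonunimodularLevels.lean` we PROVE:

* `minNbrWeight G o = Δ`, the least weight of a neighbour of `o` (the weight of `ℓ_1`), attained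
  (`exists_adj_autWeight_eq_minNbrWeight`), with `0 < Δ < 1` (`minNbrWeight_lt_one`: `o` has a
  neighbour below it, `exists_neighbor_below`);
* **every edge changes the weight by a factor in `[Δ, Δ⁻¹]`** (`minNbrWeight_mul_le_of_adj`:
  `Δ w(x) ≤ w(y)` for `x ∼ y`, by transitivity and `autWeight_map_mul`);
* **long edges everywhere**: every vertex `x` has a neighbour of weight exactly `Δ w(x)`
  (`exists_adj_autWeight_eq_mul`) and one of weight `w` with `Δ w = w(x)`
  (`exists_adj_mul_autWeight_eq`); hence the levels `ℓ_n = {w = Δ^n}` are all nonempty and joined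
  to `o` by paths of long edges (`exists_walk_autWeight_eq_pow`);
* **slabs**: `slab G o j = G(ℓ_{j+1}, ℓ_j] = {v : Δ^{j+1} < w(v) ≤ Δ^j}`; every vertex of weight
  `≤ 1` lies in exactly one slab (`exists_unique_mem_slab`), the slabs are pairwise disjoint, and
  **the slabs separate**: a walk from a vertex of weight `> Δ^j` to a vertex of weight `≤ Δ^j`
  visits `slab G o j` (`exists_mem_support_mem_slab`) — the property "there is no path from the
  vertices above `l_1` to the vertices below `l_2` that is disjoint from `L`" for
  `L = G(ℓ_{j+1}, ℓ_j]`.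

## References

* Á. Timár, Ann. Probab. 34 (2006) 2344–2364 (arXiv:math/0702875), §4: p. 2352 (`G(ℓ', ℓ]`),
  p. 2353 (separating sets of levels), pp. 2354–2355 (proof of Thm. 4.3: `ℓ_1`, long edges, `Δ`,
  `ℓ_i`, "`(G(ℓ_{i+1}, ℓ_i])_i` is a sequence of separating sets of levels"). [Timar2006]
* R. Lyons, Y. Peres, *Probability on Trees and Networks*, CUP 2016, §8.2, Thm. 8.10 (weights),
  Exercise 8.28 (`sup μ = ∞`, `inf μ = 0` on nonunimodular graphs). [LyonsPeres2016]
-/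

noncomputable section

namespace Literature.Barriers.CriticalPhenomena

open scoped ENNReal

variable {V : Type*}

/-! ### `Δ`: the weight of the lowest level adjacent to `o` -/

/-- `Δ`: the least weight `w(y)` (`w = autWeight G o`, `w(o) = 1`) of a neighbour `y` of `o` —
the weight of "`ℓ_1`, the lowest level that contains a vertex adjacent (in `G`) to `o`" (Timár
2006, proof of Thm. 4.3). For an isolated `o` the value is `⊤` (`Finset.inf` over `∅`).
[cite: Timar2006, §4 (proof of Thm. 4.3: ℓ_1 and Δ)] -/
def minNbrWeight (G : SimpleGraph V) [G.LocallyFinite] (o : V) : ℝ≥0∞ :=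
  (G.neighborFinset o).inf (autWeight G o)

/-- `Δ ≤ w(y)` for every neighbour `y` of `o`. [cite: Timar2006, §4 (proof of Thm. 4.3: ℓ_1 is the lowest level adjacent to o)] -/
theorem minNbrWeight_le_of_adj {G : SimpleGraph V} [G.LocallyFinite] {o y : V} (h : G.Adj o y) :
    minNbrWeight G o ≤ autWeight G o y :=
  Finset.inf_le ((G.mem_neighborFinset o y).2 h)

/-- `Δ` is attained: some neighbour of `o` has weight `Δ` (a vertex of `ℓ_1` joined to `o` by a
long edge), provided `o` has a neighbour. [cite: Timar2006, §4 (proof of Thm. 4.3: long edges from o)] -/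
theorem exists_adj_autWeight_eq_minNbrWeight {G : SimpleGraph V} [G.LocallyFinite] {o : V}
    (h : (G.neighborFinset o).Nonempty) : ∃ y : V, G.Adj o y ∧ autWeight G o y = minNbrWeight G o := by
  obtain ⟨y, hy, heq⟩ := Finset.exists_mem_eq_inf (G.neighborFinset o) h (autWeight G o)
  exact ⟨y, (G.mem_neighborFinset o y).1 hy, heq.symm⟩

/-- On a connected, locally finite, transitive nonunimodular graph, `Δ < 1 = w(o)`: `o` has a
neighbour below it. [cite: Timar2006, §4 (proof of Thm. 4.3: ℓ_1 is below ℓ_0)] -/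
theorem minNbrWeight_lt_one {G : SimpleGraph V} [G.LocallyFinite] (hconn : G.Connected)
    (ht : IsGraphTransitive G) (hU : ¬ IsGraphUnimodular G) (o : V) : minNbrWeight G o < 1 := by
  obtain ⟨y, hoy, habove⟩ := exists_neighbor_below hconn ht hU o
  rw [isAbove_iff_autWeight_lt G hconn o, autWeight_self G hconn o] at habove
  exact lt_of_le_of_lt (minNbrWeight_le_of_adj hoy) habove

/-- `Δ ≠ 0` (weights are nonzero; `o` has a neighbour on a transitive nonunimodular graph).
[folklore] -/
theorem minNbrWeight_ne_zero {G : SimpleGraph V} [G.LocallyFinite] (hconn : G.Connected) (o : V) :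
    minNbrWeight G o ≠ 0 := by
  intro h0
  by_cases h : (G.neighborFinset o).Nonempty
  · obtain ⟨y, -, hy⟩ := exists_adj_autWeight_eq_minNbrWeight h
    exact autWeight_ne_zero G hconn o y (hy.trans h0)
  · rw [Finset.not_nonempty_iff_eq_empty] at h
    rw [minNbrWeight, h, Finset.inf_empty] at h0
    exact ENNReal.top_ne_zero h0

/-- `Δ ≠ ⊤` as soon as `o` has a neighbour (in particular on transitive nonunimodular graphs,
where `Δ < 1`). [folklore] -/
theorem minNbrWeight_ne_top {G : SimpleGraph V} [G.LocallyFinite] (hconn : G.Connected)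
    (ht : IsGraphTransitive G) (hU : ¬ IsGraphUnimodular G) (o : V) : minNbrWeight G o ≠ ⊤ :=
  ne_top_of_lt (minNbrWeight_lt_one hconn ht hU o)

/-! ### Edges change the weight by a factor in `[Δ, Δ⁻¹]`; long edges from every vertex -/

/-- **Along an edge the weight drops by at most the factor `Δ`**: `Δ · w(x) ≤ w(y)` for `x ∼ y`
on a connected, locally finite, transitive graph (move `x` to `o` by an automorphism `γ`; then
`γy ∼ o` has weight `≥ Δ`, and `w(γy) w(x) = w(γx) w(y) = w(y)` by `autWeight_map_mul`).
[cite: Timar2006, §4 (proof of Thm. 4.3: ℓ_1 is the lowest level adjacent to o)] -/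
theorem minNbrWeight_mul_le_of_adj {G : SimpleGraph V} [G.LocallyFinite] (hconn : G.Connected)
    (ht : IsGraphTransitive G) (o : V) {x y : V} (hxy : G.Adj x y) :
    minNbrWeight G o * autWeight G o x ≤ autWeight G o y := by
  obtain ⟨γ, hγ⟩ := ht x o
  have hadj : G.Adj o (γ y) := by rw [← hγ]; exact (γ.map_rel_iff').2 hxy
  have hkey := autWeight_map_mul G hconn γ o y x   -- w(γy) w(x) = w(γx) w(y)
  rw [hγ, autWeight_self G hconn o, one_mul] at hkey
  calc minNbrWeight G o * autWeight G o x ≤ autWeight G o (γ y) * autWeight G o x := by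
        gcongr; exact minNbrWeight_le_of_adj hadj
    _ = autWeight G o y := hkey

/-- Symmetrically `Δ · w(y) ≤ w(x)` for `x ∼ y`: the weight rises along an edge by at most the
factor `Δ⁻¹`. [cite: Timar2006, §4 (proof of Thm. 4.3)] -/
theorem minNbrWeight_mul_le_of_adj' {G : SimpleGraph V} [G.LocallyFinite] (hconn : G.Connected)
    (ht : IsGraphTransitive G) (o : V) {x y : V} (hxy : G.Adj x y) :
    minNbrWeight G o * autWeight G o y ≤ autWeight G o x :=
  minNbrWeight_mul_le_of_adj hconn ht o hxy.symm

/-- **Long edges from every vertex**: on a connected, locally finite, transitive nonunimodular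
graph every vertex `x` has a neighbour of weight exactly `Δ · w(x)` (the image of a long edge
from `o` under an automorphism taking `o` to `x`; "One can define `G'(x)`, for any `x ∈ V(G)`, as
the image of `G'(o)` by some (arbitrarily fixed) automorphism of `G` that takes `o` to `x`").
[cite: Timar2006, §4 (proof of Thm. 4.3: long edges, G'(x))] -/
theorem exists_adj_autWeight_eq_mul {G : SimpleGraph V} [G.LocallyFinite] (hconn : G.Connected)
    (ht : IsGraphTransitive G) (hU : ¬ IsGraphUnimodular G) (o x : V) :
    ∃ y : V, G.Adj x y ∧ autWeight G o y = minNbrWeight G o * autWeight G o x := by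
  obtain ⟨o', hoo', ho'⟩ := exists_adj_autWeight_eq_minNbrWeight (G := G) (o := o)
    (let ⟨y, hy, _⟩ := exists_neighbor_below hconn ht hU o; ⟨y, (G.mem_neighborFinset o y).2 hy⟩)
  obtain ⟨γ, hγ⟩ := ht o x
  refine ⟨γ o', by rw [← hγ]; exact (γ.map_rel_iff').2 hoo', ?_⟩
  have hkey := autWeight_map_mul G hconn γ o o' o   -- w(γo') w(o) = w(γo) w(o')
  rw [autWeight_self G hconn o, mul_one, hγ, ho', mul_comm] at hkey
  exact hkey

/-- Likewise every vertex `x` has a neighbour `y` one long edge ABOVE it: `Δ · w(y) = w(x)`.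
[cite: Timar2006, §4 (proof of Thm. 4.3: long edges)] -/
theorem exists_adj_mul_autWeight_eq {G : SimpleGraph V} [G.LocallyFinite] (hconn : G.Connected)
    (ht : IsGraphTransitive G) (hU : ¬ IsGraphUnimodular G) (o x : V) :
    ∃ y : V, G.Adj x y ∧ minNbrWeight G o * autWeight G o y = autWeight G o x := by
  obtain ⟨o', hoo', ho'⟩ := exists_adj_autWeight_eq_minNbrWeight (G := G) (o := o)
    (let ⟨y, hy, _⟩ := exists_neighbor_below hconn ht hU o; ⟨y, (G.mem_neighborFinset o y).2 hy⟩)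
  obtain ⟨γ, hγ⟩ := ht o' x
  refine ⟨γ o, by rw [← hγ]; exact (γ.map_rel_iff').2 hoo'.symm, ?_⟩
  have hkey := autWeight_map_mul G hconn γ o o' o   -- w(γo') w(o) = w(γo) w(o')
  rw [autWeight_self G hconn o, mul_one, hγ, ho', mul_comm] at hkey
  exact hkey.symm

/-- **The levels `ℓ_n` (weight `Δ^n w(x)` below any `x`) are reached by paths of long edges**:
for every `x` and `n` there is a walk of length `n` from `x` to a vertex of weight `Δ^n w(x)`.
[cite: Timar2006, §4 (proof of Thm. 4.3: "let ℓ_i be the level with weight Δ^i")] -/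
theorem exists_walk_autWeight_eq_pow {G : SimpleGraph V} [G.LocallyFinite] (hconn : G.Connected)
    (ht : IsGraphTransitive G) (hU : ¬ IsGraphUnimodular G) (o x : V) (n : ℕ) :
    ∃ (y : V) (p : G.Walk x y), p.length = n ∧
      autWeight G o y = minNbrWeight G o ^ n * autWeight G o x := by
  induction n with
  | zero => exact ⟨x, SimpleGraph.Walk.nil, rfl, by rw [pow_zero, one_mul]⟩
  | succ n ih =>
    obtain ⟨y, p, hp, hy⟩ := ih
    obtain ⟨z, hyz, hz⟩ := exists_adj_autWeight_eq_mul hconn ht hU o y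
    refine ⟨z, p.append (SimpleGraph.Walk.cons hyz SimpleGraph.Walk.nil), ?_, ?_⟩
    · rw [SimpleGraph.Walk.length_append, hp]; rfl
    · rw [hz, hy, pow_succ]; ring

/-- In particular every level `ℓ_n = {v : w(v) = Δ^n}` (`n ∈ ℕ`) is nonempty.
[cite: Timar2006, §4 (proof of Thm. 4.3: the levels ℓ_i)] -/
theorem exists_autWeight_eq_pow {G : SimpleGraph V} [G.LocallyFinite] (hconn : G.Connected)
    (ht : IsGraphTransitive G) (hU : ¬ IsGraphUnimodular G) (o : V) (n : ℕ) :
    ∃ y : V, autWeight G o y = minNbrWeight G o ^ n := by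
  obtain ⟨y, -, -, hy⟩ := exists_walk_autWeight_eq_pow hconn ht hU o o n
  exact ⟨y, by rw [hy, autWeight_self G hconn o, mul_one]⟩

/-- And the levels above `o`, `{v : Δ^n w(v) = 1}`, are nonempty too (so `sup w = ∞` and
`inf w = 0`, Lyons–Peres 2016, Exercise 8.28). [cite: LyonsPeres2016, §8.2 (Exercise 8.28)] -/
theorem exists_pow_mul_autWeight_eq_one {G : SimpleGraph V} [G.LocallyFinite] (hconn : G.Connected)
    (ht : IsGraphTransitive G) (hU : ¬ IsGraphUnimodular G) (o : V) (n : ℕ) :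
    ∃ y : V, minNbrWeight G o ^ n * autWeight G o y = 1 := by
  induction n with
  | zero => exact ⟨o, by rw [pow_zero, one_mul, autWeight_self G hconn o]⟩
  | succ n ih =>
    obtain ⟨y, hy⟩ := ih
    obtain ⟨z, -, hz⟩ := exists_adj_mul_autWeight_eq hconn ht hU o y
    exact ⟨z, by rw [pow_succ, mul_assoc, hz, hy]⟩

/-! ### Slabs `G(ℓ_{j+1}, ℓ_j]` and their separating property -/

/-- The **slab** `G(ℓ_{j+1}, ℓ_j]`: the vertices between `ℓ_j` and `ℓ_{j+1}`, i.e. of weight in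
`(Δ^{j+1}, Δ^j]` ("the set of vertices above `ℓ'` and below `ℓ` together with `ℓ` (but not
including `ℓ'`) will be called the vertices *between* `ℓ` and `ℓ'`", Timár 2006, §4, with
`ℓ = ℓ_j`, `ℓ' = ℓ_{j+1}`). [cite: Timar2006, §4 (G(ℓ', ℓ] and G(ℓ_{i+1}, ℓ_i])] -/
def slab (G : SimpleGraph V) [G.LocallyFinite] (o : V) (j : ℕ) : Set V :=
  {v | minNbrWeight G o ^ (j + 1) < autWeight G o v ∧ autWeight G o v ≤ minNbrWeight G o ^ j}

/-- Membership in a slab, unfolded. [folklore] -/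
theorem mem_slab_iff {G : SimpleGraph V} [G.LocallyFinite] {o : V} {j : ℕ} {v : V} :
    v ∈ slab G o j ↔
      minNbrWeight G o ^ (j + 1) < autWeight G o v ∧ autWeight G o v ≤ minNbrWeight G o ^ j :=
  Iff.rfl

/-- `o ∈ G(ℓ_1, ℓ_0]`. [folklore] -/
theorem mem_slab_zero {G : SimpleGraph V} [G.LocallyFinite] (hconn : G.Connected)
    (ht : IsGraphTransitive G) (hU : ¬ IsGraphUnimodular G) (o : V) : o ∈ slab G o 0 := by
  rw [mem_slab_iff, autWeight_self G hconn o, zero_add, pow_one, pow_zero]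
  exact ⟨minNbrWeight_lt_one hconn ht hU o, le_rfl⟩

/-- Powers of `Δ ∈ (0, 1)` decrease strictly. [folklore] -/
theorem minNbrWeight_pow_lt_pow {G : SimpleGraph V} [G.LocallyFinite] (hconn : G.Connected)
    (ht : IsGraphTransitive G) (hU : ¬ IsGraphUnimodular G) (o : V) {m n : ℕ} (h : m < n) :
    minNbrWeight G o ^ n < minNbrWeight G o ^ m := by
  obtain ⟨k, rfl⟩ := Nat.exists_eq_add_of_lt h
  have h0 : minNbrWeight G o ^ m ≠ 0 := pow_ne_zero _ (minNbrWeight_ne_zero hconn o)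
  have hT : minNbrWeight G o ^ m ≠ ⊤ := ENNReal.pow_ne_top (minNbrWeight_ne_top hconn ht hU o)
  calc minNbrWeight G o ^ (m + k + 1) = minNbrWeight G o ^ m * minNbrWeight G o ^ (k + 1) := by
        ring
    _ < minNbrWeight G o ^ m * 1 :=
        ENNReal.mul_lt_mul_right h0 hT
          (pow_lt_one' (minNbrWeight_lt_one hconn ht hU o) (Nat.succ_ne_zero k))
    _ = minNbrWeight G o ^ m := mul_one _

/-- Powers of `Δ ∈ (0, 1)` are antitone, iff form. [folklore] -/
theorem minNbrWeight_pow_le_pow_iff {G : SimpleGraph V} [G.LocallyFinite] (hconn : G.Connected)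
    (ht : IsGraphTransitive G) (hU : ¬ IsGraphUnimodular G) (o : V) {m n : ℕ} :
    minNbrWeight G o ^ n ≤ minNbrWeight G o ^ m ↔ m ≤ n := by
  constructor
  · intro h
    by_contra hlt
    exact absurd h (not_le.2 (minNbrWeight_pow_lt_pow hconn ht hU o (not_le.1 hlt)))
  · intro h
    exact pow_le_pow_right_of_le_one' (minNbrWeight_lt_one hconn ht hU o).le h

/-- **The slabs are pairwise disjoint.** [cite: Timar2006, §4 (Lemma 4.2: pairwise disjoint separating sets of levels)] -/
theorem slab_disjoint {G : SimpleGraph V} [G.LocallyFinite] (hconn : G.Connected)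
    (ht : IsGraphTransitive G) (hU : ¬ IsGraphUnimodular G) (o : V) {i j : ℕ} (h : i ≠ j) :
    Disjoint (slab G o i) (slab G o j) := by
  wlog hij : i < j generalizing i j
  · exact (this h.symm (lt_of_le_of_ne (not_lt.1 hij) h.symm)).symm
  rw [Set.disjoint_left]
  rintro v ⟨hi, -⟩ ⟨-, hj⟩
  have : minNbrWeight G o ^ j ≤ minNbrWeight G o ^ (i + 1) :=
    (minNbrWeight_pow_le_pow_iff hconn ht hU o).2 hij
  exact absurd (lt_of_lt_of_le hi (hj.trans this)) (lt_irrefl _)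

/-- **Every vertex of weight at most `1 = w(o)` lies in exactly one slab** `G(ℓ_{j+1}, ℓ_j]`,
`j ∈ ℕ` ("`⋃_i L_i` contains all the vertices below `o`", the hypothesis of Lemma 4.2, for the
grid slabs). [cite: Timar2006, §4 (Lemma 4.2 and proof of Thm. 4.3: the slabs cover everything below o)] -/
theorem exists_unique_mem_slab {G : SimpleGraph V} [G.LocallyFinite] (hconn : G.Connected)
    (ht : IsGraphTransitive G) (hU : ¬ IsGraphUnimodular G) (o : V) {v : V}
    (hv : autWeight G o v ≤ 1) : ∃! j : ℕ, v ∈ slab G o j := by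
  classical
  -- existence: `Δ^n → 0 < w(v)`, take the first `n` with `Δ^n < w(v)`; it is `≥ 1`
  have hex : ∃ n : ℕ, minNbrWeight G o ^ n < autWeight G o v := by
    have hlim := ENNReal.tendsto_pow_atTop_nhds_zero_iff.2 (minNbrWeight_lt_one hconn ht hU o)
    exact ((hlim.eventually (gt_mem_nhds (pos_iff_ne_zero.2 (autWeight_ne_zero G hconn o v))))).exists
  have hn_spec : minNbrWeight G o ^ Nat.find hex < autWeight G o v := Nat.find_spec hex
  have hn0 : Nat.find hex ≠ 0 := by
    intro h0
    rw [h0, pow_zero] at hn_spec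
    exact absurd hv (not_le.2 hn_spec)
  obtain ⟨j, hj⟩ := Nat.exists_eq_succ_of_ne_zero hn0
  rw [hj] at hn_spec
  have hj' : ¬ minNbrWeight G o ^ j < autWeight G o v :=
    Nat.find_min hex (by rw [hj]; exact Nat.lt_succ_self j)
  refine ⟨j, ⟨hn_spec, not_lt.1 hj'⟩, fun i hi => ?_⟩
  -- uniqueness: slabs are disjoint
  by_contra hne
  exact Set.disjoint_left.1 (slab_disjoint hconn ht hU o hne) hi ⟨hn_spec, not_lt.1 hj'⟩

/-- **The slabs separate** ("there is no path from the vertices above `l_1` to the vertices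
below `l_2` that is disjoint from `L`", here for `L = G(ℓ_{j+1}, ℓ_j]`): a walk from a vertex of
weight `> Δ^j` to a vertex of weight `≤ Δ^j` passes through `slab G o j` — the first vertex of
weight `≤ Δ^j` along the walk has weight `> Δ^{j+1}`, because one edge lowers the weight by at
most the factor `Δ` (`minNbrWeight_mul_le_of_adj`).
[cite: Timar2006, §4 (separating sets of levels; "(G(ℓ_{i+1}, ℓ_i])_i is a sequence of separating sets of levels")] -/
theorem exists_mem_support_mem_slab {G : SimpleGraph V} [G.LocallyFinite] (hconn : G.Connected)
    (ht : IsGraphTransitive G) (hU : ¬ IsGraphUnimodular G) (o : V) (j : ℕ) :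
    ∀ {u v : V} (p : G.Walk u v), minNbrWeight G o ^ j < autWeight G o u →
      autWeight G o v ≤ minNbrWeight G o ^ j → ∃ x ∈ p.support, x ∈ slab G o j
  | _, _, .nil, hu, hv => absurd hv (not_le.2 hu)
  | u, v, .cons (v := u') hadj p, hu, hv => by
    by_cases hu' : minNbrWeight G o ^ j < autWeight G o u'
    · obtain ⟨x, hx, hxs⟩ := exists_mem_support_mem_slab hconn ht hU o j p hu' hv
      have hmem : x ∈ (SimpleGraph.Walk.cons hadj p).support := by
        rw [SimpleGraph.Walk.support_cons]; exact List.mem_cons_of_mem _ hx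
      exact ⟨x, hmem, hxs⟩
    · have hmem : u' ∈ (SimpleGraph.Walk.cons hadj p).support := by
        rw [SimpleGraph.Walk.support_cons]; exact List.mem_cons_of_mem _ p.start_mem_support
      refine ⟨u', hmem, ?_, not_lt.1 hu'⟩
      -- `Δ^{j+1} < Δ w(u) ≤ w(u')`
      calc minNbrWeight G o ^ (j + 1) = minNbrWeight G o * minNbrWeight G o ^ j := by ring
        _ < minNbrWeight G o * autWeight G o u :=
            ENNReal.mul_lt_mul_right (minNbrWeight_ne_zero hconn o)
              (minNbrWeight_ne_top hconn ht hU o) hu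
        _ ≤ autWeight G o u' := minNbrWeight_mul_le_of_adj hconn ht o hadj

/-- In particular an edge never skips a slab downwards: if `x ∼ y` with `w(x) > Δ^j ≥ w(y)` then
`y ∈ G(ℓ_{j+1}, ℓ_j]`. [cite: Timar2006, §4 (separating sets of levels)] -/
theorem mem_slab_of_adj {G : SimpleGraph V} [G.LocallyFinite] (hconn : G.Connected)
    (ht : IsGraphTransitive G) (hU : ¬ IsGraphUnimodular G) (o : V) {j : ℕ} {x y : V}
    (hxy : G.Adj x y) (hx : minNbrWeight G o ^ j < autWeight G o x)
    (hy : autWeight G o y ≤ minNbrWeight G o ^ j) : y ∈ slab G o j := by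
  refine ⟨?_, hy⟩
  calc minNbrWeight G o ^ (j + 1) = minNbrWeight G o * minNbrWeight G o ^ j := by ring
    _ < minNbrWeight G o * autWeight G o x :=
        ENNReal.mul_lt_mul_right (minNbrWeight_ne_zero hconn o) (minNbrWeight_ne_top hconn ht hU o) hx
    _ ≤ autWeight G o y := minNbrWeight_mul_le_of_adj hconn ht o hxy

/-- A long edge from a vertex of `G(ℓ_{j+1}, ℓ_j]` lands in the next slab `G(ℓ_{j+2}, ℓ_{j+1}]`
(the vertex `x'` of the definition of `G'(x)` lies one slab down).
[cite: Timar2006, §4 (proof of Thm. 4.3: x' and G'(x))] -/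
theorem mem_slab_succ_of_autWeight_eq_mul {G : SimpleGraph V} [G.LocallyFinite]
    (hconn : G.Connected) (ht : IsGraphTransitive G) (hU : ¬ IsGraphUnimodular G) (o : V)
    {j : ℕ} {x y : V} (hx : x ∈ slab G o j)
    (hy : autWeight G o y = minNbrWeight G o * autWeight G o x) : y ∈ slab G o (j + 1) := by
  have h0 := minNbrWeight_ne_zero hconn o
  have hT := minNbrWeight_ne_top hconn ht hU o
  obtain ⟨hx1, hx2⟩ := hx
  refine ⟨?_, ?_⟩
  · calc minNbrWeight G o ^ (j + 1 + 1) = minNbrWeight G o * minNbrWeight G o ^ (j + 1) := by ring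
      _ < minNbrWeight G o * autWeight G o x := ENNReal.mul_lt_mul_right h0 hT hx1
      _ = autWeight G o y := hy.symm
  · calc autWeight G o y = minNbrWeight G o * autWeight G o x := hy
      _ ≤ minNbrWeight G o * minNbrWeight G o ^ j := by gcongr
      _ = minNbrWeight G o ^ (j + 1) := by ring

end Literature.Barriers.CriticalPhenomena

end
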